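import Mathlib

/-!
# PneNP / OverlapGapAlgebra — crux `SolvableImpliesStableSection` (stmt-PneNP-2463):
# the PURE-LITERAL peeling block (1/5) — exact counts of literal path patterns

Support for crux `stmt-PneNP-2463` (`Summit.PneNP.PneNP.Theses.OverlapGapAlgebra.SolvableImpliesStableSection`):
the f-free block "bounded-round pure-literal peeling gives stable sections for `k α < 2`" — the literal
refinement of the private-variable peeling block (`…PeelingPathCount.lean` etc., threshold `k α < 1`).
A clause of `F_k(n, m)` that survives `R` rounds of parallel pure-literal peeling (a clause is peeled as
soon as the COMPLEMENT of one of its literals occurs in no other surviving clause) has a witness path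
`c₀ = i, c₁, …, c_R` with up-slots `u_d`: clause `c_{d+1} ≠ c_d` carries at slot `u_{d+1}` the complement
of the LITERAL of slot `dn(u_d) ≠ u_d` of `c_d` — a literal equation, of probability `1/(2n)` instead of
the `1/n` of a variable equation.  This file counts the instances realising such equations:

* `sissQ_card_filter_lit_mul` — the literal slot fibre: if `P` and `w` do not read slot `(c, j)`, then
  `#{Φ : P Φ ∧ Φ c j = w Φ} · 2n = #{Φ : P Φ}`;
* `sissQ_pathCount` — for an injective clause sequence the `L` literal path equations are realised by
  exactly `#Inst / (2n)^L` instances;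
* `sissQ_pathCount_extra` — with one more literal equation on the fresh slot `(c_L, dn u_L)`:
  `#{Φ : eqs ∧ extra} · (2n)^{L+1} = #Inst`.
No definitions; axioms `propext`, `Classical.choice`, `Quot.sound`.
-/

set_option linter.dupNamespace false -- `Summit.PneNP.PneNP.…`: summit = sub-problem (D-0017)

namespace Summit.PneNP.PneNP.Theorems

open Finset
open scoped Classical

section PurePath

variable {m k n : ℕ}

/-- **The literal slot fibre.** If the predicate `P` and the function `w` do not read slot `(c, j)`
(they are invariant under re-setting it), then among the instances satisfying `P` exactly a `1/(2n)`
fraction has literal `w` at slot `(c, j)`: `#{Φ : P Φ ∧ Φ c j = w Φ} · 2n = #{Φ : P Φ}`. -/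
theorem sissQ_card_filter_lit_mul (c : Fin m) (j : Fin k)
    (P : (Fin m → Fin k → Fin n × Bool) → Prop) [DecidablePred P]
    (w : (Fin m → Fin k → Fin n × Bool) → Fin n × Bool)
    (hP : ∀ (Φ : Fin m → Fin k → Fin n × Bool) (x : Fin n × Bool),
      P (Function.update Φ c (Function.update (Φ c) j x)) ↔ P Φ)
    (hw : ∀ (Φ : Fin m → Fin k → Fin n × Bool) (x : Fin n × Bool),
      w (Function.update Φ c (Function.update (Φ c) j x)) = w Φ) :
    ((univ : Finset (Fin m → Fin k → Fin n × Bool)).filter fun Φ => P Φ ∧ Φ c j = w Φ).card * (2 * n)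
      = ((univ : Finset (Fin m → Fin k → Fin n × Bool)).filter fun Φ => P Φ).card := by
  set T : (Fin m → Fin k → Fin n × Bool) → (Fin n × Bool) → (Fin m → Fin k → Fin n × Bool) :=
    fun Φ x => Function.update Φ c (Function.update (Φ c) j x) with hT
  have hTapply : ∀ Φ x, (T Φ x) c j = x := fun Φ x => by simp [hT]
  have hTT : ∀ Φ x y, T (T Φ x) y = T Φ y := fun Φ x y => by
    funext a b
    by_cases ha : a = c
    · subst ha
      by_cases hb : b = j
      · subst hb; simp [hT]
      · simp [hT, hb]
    · simp [hT, ha]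
  have hTself : ∀ Φ, T Φ (Φ c j) = Φ := fun Φ => by simp [hT]
  set A := (univ : Finset (Fin m → Fin k → Fin n × Bool)).filter fun Φ => P Φ ∧ Φ c j = w Φ
    with hA
  set B := (univ : Finset (Fin m → Fin k → Fin n × Bool)).filter fun Φ => P Φ with hB
  have hcard : (A ×ˢ (univ : Finset (Fin n × Bool))).card = B.card := by
    refine Finset.card_bij' (fun p _ => T p.1 p.2) (fun Φ _ => (T Φ (w Φ), Φ c j)) ?_ ?_ ?_ ?_
    · rintro ⟨Φ, x⟩ hp
      rw [Finset.mem_product, hA, Finset.mem_filter] at hp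
      rw [hB, Finset.mem_filter]
      exact ⟨mem_univ _, (hP Φ x).2 hp.1.2.1⟩
    · intro Φ hΦ
      rw [hB, Finset.mem_filter] at hΦ
      rw [Finset.mem_product, hA, Finset.mem_filter]
      refine ⟨⟨mem_univ _, (hP Φ _).2 hΦ.2, ?_⟩, mem_univ _⟩
      show (T Φ (w Φ)) c j = w (T Φ (w Φ))
      rw [hTapply, hw]
    · rintro ⟨Φ, x⟩ hp
      rw [Finset.mem_product, hA, Finset.mem_filter] at hp
      have heq : Φ c j = w Φ := hp.1.2.2
      ext1
      · show T (T Φ x) (w (T Φ x)) = Φ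
        rw [hw, hTT, ← heq, hTself]
      · show (T Φ x) c j = x
        rw [hTapply]
    · intro Φ _
      show T (T Φ (w Φ)) (Φ c j) = Φ
      rw [hTT, hTself]
  rw [← hcard, Finset.card_product, Finset.card_univ, Fintype.card_prod, Fintype.card_fin,
    Fintype.card_bool, mul_comm n 2]

/-- **Exact count of an injective literal path pattern.** Let `c : ℕ → Fin m` be injective on
`[0, L]`, `u : ℕ → Fin k` and `dn : Fin k → Fin k` arbitrary. The instances in which, for every `d < L`,
clause `c (d+1)` carries at slot `u (d+1)` the complement of the literal of slot `dn (u d)` of clause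
`c d` number exactly `#Inst / (2n)^L`: `#{Φ : eqs} · (2n)^L = #Inst`. -/
theorem sissQ_pathCount (dn : Fin k → Fin k) (u : ℕ → Fin k) :
    ∀ (L : ℕ) (c : ℕ → Fin m), (∀ a b, a ≤ L → b ≤ L → c a = c b → a = b) →
      ((univ : Finset (Fin m → Fin k → Fin n × Bool)).filter fun Φ =>
          ∀ d, d < L → Φ (c (d + 1)) (u (d + 1)) =
            ((Φ (c d) (dn (u d))).1, !(Φ (c d) (dn (u d))).2)).card * (2 * n) ^ L
        = Fintype.card (Fin m → Fin k → Fin n × Bool) := by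
  intro L
  induction L with
  | zero =>
    intro c _
    simp
  | succ L ih =>
    intro c hinj
    have hinjL : ∀ a b, a ≤ L → b ≤ L → c a = c b → a = b :=
      fun a b ha hb h => hinj a b (Nat.le_succ_of_le ha) (Nat.le_succ_of_le hb) h
    have hIH := ih c hinjL
    have hne : ∀ d, d ≤ L → c d ≠ c (L + 1) := by
      intro d hd h
      have := hinj d (L + 1) (Nat.le_succ_of_le hd) le_rfl h
      omega
    have hstep := sissQ_card_filter_lit_mul (n := n) (c (L + 1)) (u (L + 1))
      (fun Φ => ∀ d, d < L → Φ (c (d + 1)) (u (d + 1)) =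
        ((Φ (c d) (dn (u d))).1, !(Φ (c d) (dn (u d))).2))
      (fun Φ => ((Φ (c L) (dn (u L))).1, !(Φ (c L) (dn (u L))).2)) ?_ ?_
    rotate_left
    · intro Φ x
      refine forall_congr' fun d => forall_congr' fun hd => ?_
      have h1 : c (d + 1) ≠ c (L + 1) := hne (d + 1) (by omega)
      have h2 : c d ≠ c (L + 1) := hne d (by omega)
      rw [Function.update_of_ne h1, Function.update_of_ne h2]
    · intro Φ x
      have h2 : c L ≠ c (L + 1) := hne L le_rfl
      simp only [Function.update_of_ne h2]
    have hsplit : ((univ : Finset (Fin m → Fin k → Fin n × Bool)).filter fun Φ =>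
          ∀ d, d < L + 1 → Φ (c (d + 1)) (u (d + 1)) =
            ((Φ (c d) (dn (u d))).1, !(Φ (c d) (dn (u d))).2))
        = (univ : Finset (Fin m → Fin k → Fin n × Bool)).filter fun Φ =>
          (∀ d, d < L → Φ (c (d + 1)) (u (d + 1)) =
            ((Φ (c d) (dn (u d))).1, !(Φ (c d) (dn (u d))).2)) ∧
            Φ (c (L + 1)) (u (L + 1)) = ((Φ (c L) (dn (u L))).1, !(Φ (c L) (dn (u L))).2) := by
      refine Finset.filter_congr fun Φ _ => ⟨fun h => ⟨fun d hd => h d (by omega), h L (by omega)⟩,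
        fun h d hd => ?_⟩
      rcases Nat.lt_succ_iff_lt_or_eq.1 hd with hd' | rfl
      · exact h.1 d hd'
      · exact h.2
    rw [hsplit, pow_succ, ← mul_assoc, mul_comm _ (2 * n), ← mul_assoc, mul_comm (2 * n), ← hIH]
    congr 1

/-- **Exact count of an injective literal path pattern with one collision equation.** As
`sissQ_pathCount` (`c` injective on `[0, L]`, `dn (u L) ≠ u L`), plus one more equation tying the FRESH
slot `(c L, dn (u L))` of the last clause to the complement of the literal of slot `j` of an earlier
clause `c a`, `a < L`: `#{Φ : eqs ∧ extra} · (2n)^{L+1} = #Inst`. -/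
theorem sissQ_pathCount_extra (dn : Fin k → Fin k) (u : ℕ → Fin k) (L : ℕ) (c : ℕ → Fin m)
    (hinj : ∀ a b, a ≤ L → b ≤ L → c a = c b → a = b) (hdn : dn (u L) ≠ u L)
    (a : ℕ) (ha : a < L) (j : Fin k) :
    ((univ : Finset (Fin m → Fin k → Fin n × Bool)).filter fun Φ =>
        (∀ d, d < L → Φ (c (d + 1)) (u (d + 1)) =
          ((Φ (c d) (dn (u d))).1, !(Φ (c d) (dn (u d))).2)) ∧
          Φ (c L) (dn (u L)) = ((Φ (c a) j).1, !(Φ (c a) j).2)).card * (2 * n) ^ (L + 1)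
      = Fintype.card (Fin m → Fin k → Fin n × Bool) := by
  have hne : ∀ d, d < L → c d ≠ c L := by
    intro d hd h
    have := hinj d L hd.le le_rfl h
    omega
  have hstep := sissQ_card_filter_lit_mul (n := n) (c L) (dn (u L))
    (fun Φ => ∀ d, d < L → Φ (c (d + 1)) (u (d + 1)) =
      ((Φ (c d) (dn (u d))).1, !(Φ (c d) (dn (u d))).2))
    (fun Φ => ((Φ (c a) j).1, !(Φ (c a) j).2)) ?_ ?_
  rotate_left
  · intro Φ x
    refine forall_congr' fun d => forall_congr' fun hd => ?_
    have h2 : c d ≠ c L := hne d hd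
    rw [Function.update_of_ne h2]
    rcases Nat.lt_or_ge (d + 1) L with hd1 | hd1
    · rw [Function.update_of_ne (hne (d + 1) hd1)]
    · have hdL : d + 1 = L := by omega
      rw [hdL, Function.update_self, Function.update_of_ne hdn.symm]
  · intro Φ x
    simp only [Function.update_of_ne (hne a ha)]
  rw [pow_succ, ← mul_assoc, mul_comm _ (2 * n), ← mul_assoc, mul_comm (2 * n),
    ← sissQ_pathCount dn u L c hinj]
  congr 1

end PurePath

end Summit.PneNP.PneNP.Theorems
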